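import Summits.ABC.ABC.Theses.IneffectiveSubspace
import Summits.ABC.ABC.Theorems.IneffectiveSubspaceDeepRegimeABCCensusCellEight17Defs
import Literature.NumberTheory.DiophantineGeometry.AbcDepthCensusTurboSym

/-!
# `DeepRegimeABC` (stmt-ABC-15121): certified census — the members of the cell `ω₅ ≥ 8` below `10¹⁷`, chunk runs (B)

Compute-certificate (line lead `prover-line-stmt-ABC-15121-c3-0`, 2026-08-16; human certificate
objective) for the crux `Summit.ABC.ABC.Theses.IneffectiveSubspace.DeepRegimeABC` (abc with exponent
`1 + ε` on the deep tail `{ω₅(abc) ≥ K(ε)}`, `ω₅(n) := #{p : p⁵ ∣ n}`), with the symmetric turbo checker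
`Literature.NumberTheory.DiophantineGeometry.DepthCensus.checkTurboChunkSym` (`AbcDepthCensusTurboSym.lean`:
min-member cut, fused threshold-table walk, run-time-validated CRT unit, patterns with `A ≤ B` only;
`members_complete_of_checkTurboChunksSym`) and the MEMBER test — a candidate passes iff `gcd(a,b) ≠ 1` or
`(a,b,c)` / `(b,a,c)` is one of the thirty listed triples `cellEightMembers17`
(`…CensusCellEight17Defs.lean`, found by the independent C mirror `cert/deep_census.c`).

**The certificate these runs serve** (assembled in `…CensusCellEight17E.lean`, registered stub
`censusCellEight17`): **the abc triples with `ω₅(abc) ≥ 8` and `c ≤ 10¹⁷` are EXACTLY the thirty triples of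
`cellEightMembers17` (up to `a ↔ b`), and none of them is a hit** — the cell `ω₅ ≥ 8` begins
`23115230230115023 (= c₈), 26902725029638843 = 7⁶·11⁵·17⁵, 28575662414467904, …` and holds no abc hit below
`10¹⁷` (largest quality `0.9559…`).  The box has `46 547 712` depth patterns (`7.2·10⁷` tree nodes after
the min-member cut, `6.9·10⁸` outer steps); the cover is the 13-chunk cover `S₁₃` of depth 2
(`coversAll_S8`), spread over five files:

| chunk | patterns | outer steps | file |
|---|---|---|---|
| `[0]` | 2 199 762 | 10 959 795 | A |
| `[1, 0]`, `[2, 0]`, `[3, 0]` | 1 389 322 each | 8 185 519 each | A |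
| `[1, 1]` | 4 432 238 | 70 981 032 | A |
| `[1, 2]`, `[1, 3]` | 4 480 545 each | 73 012 957 each | B |
| `[2, 1]` / `[2, 2]` | 4 480 545 / 4 432 238 | 73 012 957 / 70 981 032 | C |
| `[2, 3]`, `[3, 1]` | 4 480 545 each | 73 012 957 each | D |
| `[3, 2]` / `[3, 3]` | 4 480 545 / 4 432 238 | 73 012 957 / 70 981 032 | E |

(measured: chunk `[1, 2]` 103 s of farm time with the symmetric turbo checker, against ≈ 530 s for the
chunked checker of the earlier census files).

**Certified here** (file B): the chunks below accept the member test.  The only computations trusted to the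
compiler are these closed `Bool` equations (`native_decide`, computational certificate lane).
-/

-- `Summit.<Summit>.<Problem>` is the mandated summit-side namespace (CONVENTIONS §2); for the
-- single-conjunct summit `ABC` the two coincide, so the duplicate `ABC.ABC` is deliberate.
set_option linter.dupNamespace false

namespace Summit.ABC.ABC.Theorems.DeepRegimeABC

open Literature.NumberTheory.DiophantineGeometry
open Literature.NumberTheory.DiophantineGeometry.DepthCensus

/-! ## The compiled chunk runs of this file -/

/-- Chunk `[1, 2]` of the cell `ω₅ ≥ 8` in the box `c ≤ 10¹⁷` (4 480 545 patterns, 73 012 957 outer steps): every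
coprime candidate is listed in `cellEightMembers17`. [folklore] -/
theorem m8chunk_12 :
    checkTurboChunkSym (10 ^ 17) 2511 8 [1, 2]
      (fun a b c => !(Nat.gcd a b == 1) || (cellEightMembers17.elem (a, b, c) || cellEightMembers17.elem (b, a, c))) = true := by
  native_decide

/-- Chunk `[1, 3]` of the cell `ω₅ ≥ 8` in the box `c ≤ 10¹⁷` (4 480 545 patterns, 73 012 957 outer steps): every
coprime candidate is listed in `cellEightMembers17`. [folklore] -/
theorem m8chunk_13 :
    checkTurboChunkSym (10 ^ 17) 2511 8 [1, 3]
      (fun a b c => !(Nat.gcd a b == 1) || (cellEightMembers17.elem (a, b, c) || cellEightMembers17.elem (b, a, c))) = true := by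
  native_decide

/-! ## Registered run stub of the crux item (stmt-ABC-15121) -/

/-- **Registered run stub `censusCellEight17RunsB`** (crux `DeepRegimeABC`, line SketchIdeator5R2, human
certificate objective): the chunk runs of this file, consumed by `…CensusCellEight17E.lean`. [folklore] -/
theorem censusCellEight17RunsB : Literature.NumberTheory.DiophantineGeometry.DepthCensus.checkTurboChunkSym (10 ^ 17) 2511 8 [1, 2] (fun a b c => !(Nat.gcd a b == 1) || (Summit.ABC.ABC.Theorems.DeepRegimeABC.cellEightMembers17.elem (a, b, c) || Summit.ABC.ABC.Theorems.DeepRegimeABC.cellEightMembers17.elem (b, a, c))) = true ∧ Literature.NumberTheory.DiophantineGeometry.DepthCensus.checkTurboChunkSym (10 ^ 17) 2511 8 [1, 3] (fun a b c => !(Nat.gcd a b == 1) || (Summit.ABC.ABC.Theorems.DeepRegimeABC.cellEightMembers17.elem (a, b, c) || Summit.ABC.ABC.Theorems.DeepRegimeABC.cellEightMembers17.elem (b, a, c))) = true :=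
  ⟨m8chunk_12, m8chunk_13⟩

end Summit.ABC.ABC.Theorems.DeepRegimeABC
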